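import Literature.Probability.RandomPlanarGeometry.SAWCubicConnectiveConstantLower
import HarnessLib

/-!
# `μ(ℤ³) > 4.27`: the irreducible-bridge certificate of `SAWCubicConnectiveConstantLower.lean` at length `12`

Topic `Literature/Probability/RandomPlanarGeometry` (continues `SAWCubicConnectiveConstantLower.lean`: the six-letter word model of
`ℤ³`, the verified acceptance test `CubicIrrCert.WordOK`, the list certificate `CubicIrrCert.certL` with its soundness
`CubicIrrCert.le_of_certL` (standard axioms), the untrusted half-space search `CubicIrrCert.dfs`, and the certified counts
`λ_n(ℤ³)` for `n ≤ 11`). One more evaluation, `λ_12(ℤ³) ≥ 914148` (the exact value), kept in its own file because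
its `native_decide` is the expensive one, and the resulting numeral: `Σ_{n ≤ 12} λ_n(ℤ³) (100/427)^n > 1`, hence
**`μ(ℤ³) > 427/100 = 4.27`** by Kesten's inequality `Σ_n λ_n μ^{-n} ≤ 1`
(`Zd.inv_lt_connectiveConstant_of_one_lt_sum`; tree so far `4.24`; the truncation at `n ≤ 12` cannot certify `4.28`, its root is `4.2739`). This bound is weaker than
print (Hara–Slade–Sokal 1993) but kernel-checked. Computational class: axioms standard plus the `native_decide` count
certificates (`Lean.ofReduceBool`).
-/

open Finset Literature.Probability.LatticeModels
open scoped BigOperators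

namespace Literature.Probability.RandomPlanarGeometry.SAW.Zd

namespace CubicIrrCert

/-! ### The evaluation at `n = 12` (computational class) -/

/-- `λ_12(ℤ³) ≥ 914148`. [cite: Jensen2004SAWLowerBounds, §2] [cite: MadrasSlade1993, Definition 4.2.1 (p. 89)] -/
theorem le_lambda_twelve : 914148 ≤ irreducibleBridgeCount 3 12 := le_of_certL (L := dfs 12) (by native_decide)

end CubicIrrCert

/-! ### The numeral -/

open CubicIrrCert in
/-- **`μ(ℤ³) > 4.27`**: `427/100 < connectiveConstant 3`, from `Σ_{n ≤ 12} λ_n(ℤ³) (100/427)^n > 1` and Kesten's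
inequality. [cite: MadrasSlade1993, Table 1.1 (p. 12), d = 3 row; §4.2, eq. (4.2.3)–(4.2.4) (pp. 90–91)]
[cite: HaraSladeSokal1993, Table 1 (p. 3) and Table 2 (p. 12)] [cite: Kesten1963SAW, §4]
[cite: Jensen2004SAWLowerBounds, §2 (Kesten's truncation principle)] -/
theorem connectiveConstant_three_gt_427_div_100 : (427 : ℝ) / 100 < connectiveConstant 3 := by
  have hx : (0 : ℝ) < 100 / 427 := by norm_num
  have key : (1 : ℝ) < ∑ k ∈ Finset.range 13, (irreducibleBridgeCount 3 k : ℝ) * (100 / 427) ^ k := by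
    have h1 : (1 : ℝ) ≤ irreducibleBridgeCount 3 1 := by exact_mod_cast le_lambda_one
    have h2 : (4 : ℝ) ≤ irreducibleBridgeCount 3 2 := by exact_mod_cast le_lambda_two
    have h3 : (12 : ℝ) ≤ irreducibleBridgeCount 3 3 := by exact_mod_cast le_lambda_three
    have h4 : (36 : ℝ) ≤ irreducibleBridgeCount 3 4 := by exact_mod_cast le_lambda_four
    have h5 : (100 : ℝ) ≤ irreducibleBridgeCount 3 5 := by exact_mod_cast le_lambda_five
    have h6 : (296 : ℝ) ≤ irreducibleBridgeCount 3 6 := by exact_mod_cast le_lambda_six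
    have h7 : (924 : ℝ) ≤ irreducibleBridgeCount 3 7 := by exact_mod_cast le_lambda_seven
    have h8 : (3276 : ℝ) ≤ irreducibleBridgeCount 3 8 := by exact_mod_cast le_lambda_eight
    have h9 : (12672 : ℝ) ≤ irreducibleBridgeCount 3 9 := by exact_mod_cast le_lambda_nine
    have h10 : (52004 : ℝ) ≤ irreducibleBridgeCount 3 10 := by exact_mod_cast le_lambda_ten
    have h11 : (217776 : ℝ) ≤ irreducibleBridgeCount 3 11 := by exact_mod_cast le_lambda_eleven
    have h12 : (914148 : ℝ) ≤ irreducibleBridgeCount 3 12 := by exact_mod_cast le_lambda_twelve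
    simp only [Finset.sum_range_succ, Finset.sum_range_zero, irreducibleBridgeCount_zero]
    generalize irreducibleBridgeCount 3 1 = a1 at h1 ⊢
    generalize irreducibleBridgeCount 3 2 = a2 at h2 ⊢
    generalize irreducibleBridgeCount 3 3 = a3 at h3 ⊢
    generalize irreducibleBridgeCount 3 4 = a4 at h4 ⊢
    generalize irreducibleBridgeCount 3 5 = a5 at h5 ⊢
    generalize irreducibleBridgeCount 3 6 = a6 at h6 ⊢
    generalize irreducibleBridgeCount 3 7 = a7 at h7 ⊢
    generalize irreducibleBridgeCount 3 8 = a8 at h8 ⊢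
    generalize irreducibleBridgeCount 3 9 = a9 at h9 ⊢
    generalize irreducibleBridgeCount 3 10 = a10 at h10 ⊢
    generalize irreducibleBridgeCount 3 11 = a11 at h11 ⊢
    generalize irreducibleBridgeCount 3 12 = a12 at h12 ⊢
    push_cast
    norm_num
    linarith [h1, h2, h3, h4, h5, h6, h7, h8, h9, h10, h11, h12]
  have := inv_lt_connectiveConstant_of_one_lt_sum 3 _ hx key
  rwa [inv_div] at this

end Literature.Probability.RandomPlanarGeometry.SAW.Zd
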